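import Literature.AlgebraicGeometry.HodgeTheory.DworkSexticFlatEigenclassesHodgeType
import HarnessLib

/-!
# The singleton flat eigenlines of the Dwork sextic fourfold are of Hodge type `(2,2)`:
# purity from symmetry and rank one (Katz 2009, Lemma 3.1, the type `(1,2,3,3,4,5)`)

Family `hodge`, layer `Literature/AlgebraicGeometry/HodgeTheory`; a sequel to
`DworkSexticFlatEigenclassesHodgeType` (purity of the flat eigenclasses of
`X_ψ : Σ xᵢ⁶ − 6ψ ∏ xᵢ = 0`, `ψ⁶ ≠ 1`, from Griffiths' residue theorem) and
`DworkSexticReflectionAveraging` (the reflections `s_(i,j,ζ)` realised on `X_ψ(ℂ)`). Written for crux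
K2 `FlatClassesSpannedByReflectionInvariants` (stmt-HodgeConjecture-20241) of route
`HodgeConjecture/DworkReflectionQuotients`.

N. M. Katz, *Another look at the Dwork family*, Progr. Math. 270 (2009), Lemma 3.1: for the
character `V = e mod 6` of `Γ_W/Δ`, `e = (1,2,3,3,4,5)` (in any order), the eigensheaf
`Prim⁴(V mod W)` has rank `#{r : V + rW totally nonzero} = 1` and is purely of Hodge type `(2,2)`.
Katz's proof of the Hodge type evaluates at the Fermat point and invokes Griffiths; the tree's
`DworkSexticFlatEigenclassesHodgeType` obtains it at every `ψ` from Griffiths' residue theorem, an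
undischarged named fact (`Griffiths1969_residues_span_hodgeFiltration`). THIS FILE proves the purity
of these 360 eigenlines by a different, elementary route that uses NO description of the Hodge
filtration — only the symmetries of `X_ψ`, complex conjugation, and the rank:

* `−e = (5,4,3,3,2,1)` is `e` read backwards, so complex conjugation (`conj V_χ ⊆ V_{χ⁻¹}`, Ran
  1980 Prop. 1.7 (iii); `conj H^{p,q} = H^{q,p}`, Voisin I Cor. 6.12) followed by pull-back along
  the coordinate permutation `x ↦ x ∘ rev` of `X_ψ` (a product of three of the transpositions
  `s_(i,j,1)` of Bini–Garbagnati §3.4, an algebraic automorphism, hence type-preserving, Voisin I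
  §7.3.2) maps `V_e ∩ H^{p,q}` conjugate-linearly and injectively into `V_e ∩ H^{q,p}`, in ONE Hodge
  model;
* if `dim V_e ≤ 1`, a non-zero class of `V_e` of type `(p,q)`, `p ≠ q`, would therefore also be of
  type `(q,p)`, which the Hodge decomposition forbids; so `V_e` has no `(p,q)`-part with `p ≠ q`,
  i.e. `V_e ⊆ H^{2,2}` (the tree's criterion `pullback_mem_hodgePQ_of_eigenspace`, Shioda 1979 §4:
  the character decomposition is compatible with the Hodge decomposition).

Contents (everything PROVED; no named fact is introduced):

* §1 `IsPermMap ψ ρ g` — `g` realises the coordinate permutation `[x] ↦ [x ∘ ρ]` on `X_ψ(ℂ)`;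
  existence for every `ρ ∈ 𝔖₆` (`exists_isPermMap`, by products of realised transpositions
  `s_(i,j,1)`, `DworkSextic.exists_continuousMap_isRefl`), uniqueness (`IsPermMap.unique`),
  composition, injectivity of `g^*`, and **type preservation in a fixed Hodge model**
  (`IsPermMap.pullback_mem_hodgePQ`, from `HodgeModel.pullback_map_mem_hodgePQ_of_endomorphism`
  applied to the scheme automorphisms `reflIso`);
* §2 `g_{a∘ρ} ∘ g_ρ = g_ρ ∘ g_a` (`diagonalMap_comp_of_isPermMap`) and the consequence
  **`g_ρ^* V_{χ_{e∘ρ}} ⊆ V_{χ_e}`** (`map_mem_eigenspace_of_isPermMap`): permutation maps permute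
  the eigenspaces of `Γ_W` (Katz §2: `𝔖ₙ` acts on the characters `V mod W`);
* §3 `eq_zero_of_pullback_mem_hodgePQ_of_ne` — a class of two different Hodge types in one model
  is zero (independence of the `H^{p,q}`, field `HodgeModel.isInternal_hodgePQ`);
* §4 **`pullback_mem_hodgePQ_two_two_of_rank_le_one`** — for `ψ⁶ ≠ 1`, a Hodge model `A`, an
  exponent vector `e` and a permutation `ρ` with `χ_{5e} = χ_{e∘ρ}` on `Γ_W` (i.e. `χ_e⁻¹` is a
  permutation-translate of `χ_e`), if `V_{χ_e} ≤ ℂ·v` for some `v` then `A^* V_{χ_e} ⊆ H^{2,2}_A`;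
* §5 the singleton type: `χ_{5e} = χ_{e∘rev}` for `e = (1,2,3,3,4,5)` (a `decide`), whence
  `pullback_mem_hodgePQ_two_two_singleton_of_rank_le_one`, its `IsEig`/`IsOfHodgeType` form, and
  **`flatClasses_mem_span_reflInvariant_singleton_of_rank_le_one`**: the `j = 0` instance of the
  crux K2 with the Katz/Griffiths input replaced by the rank hypothesis
  `∀ σ, ∃ v, V_{χ_{e∘σ}} ≤ ℂ·v` (Katz L.3.1(1), the upper bound `rank ≤ 1`, which is topological:
  Ehresmann transport to the Fermat point, where it is the tree's theorem
  `fermatEigenspace_le_span_of_ne_zero` with `fermatEigenspace_eq_bot_of_apply_eq_zero`).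

Not here, deliberately: the rank bound itself at `ψ ≠ 0` (it needs a `Γ_W`-equivariant parallel
transport along the Dwork line, not yet in the tree), and the rank-`2`/`3` flat types
`(1,2,2,3,5,5)`, `(1,1,2,4,5,5)`, `(1,1,3,3,5,5)`, for which symmetry is provably insufficient
(their stabilisers in `𝔖₆` act by scalars, so a splitting `(3,1) ⊕ (1,3)` exchanged by conjugation
is representation-theoretically consistent) — they remain on Griffiths' theorem
(`DworkSexticFlatEigenclassesHodgeType`).

## References

* [Katz2009] N. M. Katz, Another look at the Dwork family, Progr. Math. 270 (2009) 89–126, §2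
  pp. 5–7, Lemma 3.1.
* [BiniGarbagnati2012] G. Bini, A. Garbagnati, Quotients of the Dwork pencil, J. Geom. Phys. 75
  (2014) (arXiv:1207.7175), §3.4 (`𝔖₆ ⊂ Aut X_ψ`, the transpositions `s_(i,j,1)`).
* [Ran1980] Z. Ran, Cycles on Fermat hypersurfaces, Compositio Math. 42 (1980), §1 Prop. 1.7 (iii).
* [Shioda1979PJA] T. Shioda, The Hodge conjecture and the Tate conjecture for Fermat varieties,
  Proc. Japan Acad. 55A (1979), §4.
* [VoisinHodgeI2002] C. Voisin, Hodge Theory and Complex Algebraic Geometry I (2002), Cor. 6.12,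
  Thm. 6.18, §7.3.2.
* [SerreGAGA1956] J.-P. Serre, GAGA, Ann. Inst. Fourier 6 (1956), §2 n°5.
-/

noncomputable section

open CategoryTheory MvPolynomial Finset
open scoped BigOperators

namespace Literature.AlgebraicGeometry.HodgeTheory.DworkSextic

open Literature.AlgebraicGeometry.Motives Literature.AlgebraicTopology.SingularHomology

/-! ### §1 Coordinate permutations realised on `X_ψ(ℂ)` -/

section Perm

variable (ψ : ℂ)

/-- `g` realises the coordinate permutation `ρ ∈ 𝔖₆` on `X_ψ(ℂ)`: in homogeneous coordinates
`rep (pt (g x)) = t • (k ↦ x_{ρ k})`, i.e. `pt (g x) = [x ∘ ρ]` (Bini–Garbagnati §3.4: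
`𝔖₆ ⊂ Aut(X_ψ)` permuting the coordinates; for a transposition this is the clause `IsReflMap ψ i j 1`).
[cite: BiniGarbagnati2012, §3.4] -/
def IsPermMap (ρ : Equiv.Perm (Fin 6))
    (g : C(ComplexPoints (fibre ψ), ComplexPoints (fibre ψ))) : Prop :=
  ∀ x, ∃ t : ℂ, (pt ψ (g x)).rep = t • fun k => (pt ψ x).rep (ρ k)

variable {ψ}

/-- **Uniqueness of realising maps**: two continuous self-maps of `X_ψ(ℂ)` whose values have
proportional homogeneous coordinates at every point are equal (`pt ψ` is injective,
`isEmbedding_hypersurfacePoint`; representatives are non-zero). [cite: SerreGAGA1956, §2 n°5] -/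
theorem eq_of_forall_rep_smul {g g' : C(ComplexPoints (fibre ψ), ComplexPoints (fibre ψ))}
    (h : ∀ x, ∃ (w : Fin 6 → ℂ) (t t' : ℂ),
      (pt ψ (g x)).rep = t • w ∧ (pt ψ (g' x)).rep = t' • w) : g = g' := by
  have hinj := (isEmbedding_hypersurfacePoint (SmoothHypersurface.hypersurfaceι (form ψ))).injective
  refine ContinuousMap.ext fun x => hinj ?_
  obtain ⟨w, t, t', ht, ht'⟩ := h x
  have ht'0 : t' ≠ 0 := by
    rintro rfl
    exact (pt ψ (g' x)).rep_nonzero (by rw [ht', zero_smul])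
  have key : Projectivization.mk ℂ (pt ψ (g x)).rep (Projectivization.rep_nonzero _) =
      Projectivization.mk ℂ (pt ψ (g' x)).rep (Projectivization.rep_nonzero _) :=
    (Projectivization.mk_eq_mk_iff' ℂ _ _ _ _).2
      ⟨t / t', by rw [ht, ht', smul_smul, div_mul_cancel₀ t ht'0]⟩
  simpa only [Projectivization.mk_rep] using key

/-- Two realising maps of the same permutation are equal. [cite: BiniGarbagnati2012, §3.4] -/
theorem IsPermMap.unique {ρ : Equiv.Perm (Fin 6)}
    {g g' : C(ComplexPoints (fibre ψ), ComplexPoints (fibre ψ))}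
    (hg : IsPermMap ψ ρ g) (hg' : IsPermMap ψ ρ g') : g = g' :=
  eq_of_forall_rep_smul fun x => by
    obtain ⟨t, ht⟩ := hg x
    obtain ⟨t', ht'⟩ := hg' x
    exact ⟨_, t, t', ht, ht'⟩

/-- The identity realises the trivial permutation. [cite: BiniGarbagnati2012, §3.4] -/
theorem isPermMap_one : IsPermMap ψ 1 (ContinuousMap.id _) := fun x =>
  ⟨1, by rw [one_smul]; rfl⟩

/-- A realising map of the reflection `s_(i,j,1)` realises the transposition `(i j)`.
[cite: BiniGarbagnati2012, §3.4] -/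
theorem isPermMap_swap_of_isReflMap {i j : Fin 6}
    {g : C(ComplexPoints (fibre ψ), ComplexPoints (fibre ψ))} (hg : IsReflMap ψ i j 1 g) :
    IsPermMap ψ (Equiv.swap i j) g := by
  intro x
  obtain ⟨t, ht⟩ := hg x
  refine ⟨t, ?_⟩
  rw [ht]
  congr 1
  funext k
  by_cases hki : k = i
  · subst hki
    rw [if_pos rfl, one_mul, Equiv.swap_apply_left]
  · by_cases hkj : k = j
    · subst hkj
      rw [if_neg hki, if_pos rfl, inv_one, one_mul, Equiv.swap_apply_right]
    · rw [if_neg hki, if_neg hkj, Equiv.swap_apply_of_ne_of_ne hki hkj]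

/-- **Composition**: if `g` realises `ρ` and `g'` realises `ρ'` then `g ∘ g'` realises `ρ.trans ρ'`
(`k ↦ ρ' (ρ k)`; `= ρ' * ρ` in `𝔖₆`). [cite: BiniGarbagnati2012, §3.4] -/
theorem IsPermMap.comp {ρ ρ' : Equiv.Perm (Fin 6)}
    {g g' : C(ComplexPoints (fibre ψ), ComplexPoints (fibre ψ))}
    (hg : IsPermMap ψ ρ g) (hg' : IsPermMap ψ ρ' g') : IsPermMap ψ (ρ.trans ρ') (g.comp g') := by
  intro x
  obtain ⟨t', ht'⟩ := hg' x
  obtain ⟨t, ht⟩ := hg (g' x)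
  refine ⟨t * t', ?_⟩
  rw [ContinuousMap.comp_apply, ht]
  funext k
  simp only [Pi.smul_apply, smul_eq_mul, Equiv.trans_apply]
  rw [ht']
  simp only [Pi.smul_apply, smul_eq_mul]
  ring

/-- **Every coordinate permutation is realised on `X_ψ(ℂ)` by a map preserving the `(p,q)`-classes
of every fixed Hodge model** (`ψ⁶ ≠ 1`): write `ρ` as a product of transpositions; each `s_(i,j,1)`
is realised (`exists_continuousMap_isRefl`) by the analytification of the scheme automorphism
`reflIso`, which preserves `H^{p,q}_A` (`HodgeModel.pullback_map_mem_hodgePQ_of_endomorphism`,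
Voisin I §7.3.2, Serre GAGA §2 n°5). [cite: BiniGarbagnati2012, §3.4] [cite: VoisinHodgeI2002, §7.3.2] -/
theorem exists_isPermMap_pullback_mem_hodgePQ (hψ : ψ ^ 6 ≠ 1) (ρ : Equiv.Perm (Fin 6)) :
    ∃ g : C(ComplexPoints (fibre ψ), ComplexPoints (fibre ψ)), IsPermMap ψ ρ g ∧
      ∀ (A : HodgeModel 4 (fibre ψ)) (k p q : ℕ) (c : complexBetti (fibre ψ) k),
        A.pullback k c ∈ A.hodgePQ k p q →
          A.pullback k (singularCohomology.map ℂ ℂ g k c) ∈ A.hodgePQ k p q := by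
  induction ρ using Equiv.Perm.swap_induction_on with
  | one =>
    refine ⟨ContinuousMap.id _, isPermMap_one, fun A k p q c hc => ?_⟩
    rw [singularCohomology.map_id]
    exact hc
  | swap_mul f i j hij ih =>
    obtain ⟨g, hg, hH⟩ := ih
    obtain ⟨r, hr⟩ := exists_continuousMap_isRefl ψ hij (one_pow 6 : (1 : ℂ) ^ 6 = 1)
    have hr' : IsReflMap ψ i j 1 r := hr
    refine ⟨g.comp r, ?_, fun A k p q c hc => ?_⟩
    · rw [Equiv.Perm.mul_def]
      exact hg.comp (isPermMap_swap_of_isReflMap hr')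
    · rw [singularCohomology.map_comp, ModuleCat.comp_apply]
      have hgc := hH A k p q c hc
      rw [eq_mapContinuous_reflIso_of_isReflMap hij (one_pow 6) hr']
      exact A.pullback_map_mem_hodgePQ_of_endomorphism (isSmoothProjective_fibre hψ) _ hgc

/-- Every coordinate permutation is realised on `X_ψ(ℂ)` (any `ψ`). [cite: BiniGarbagnati2012, §3.4] -/
theorem exists_isPermMap (ρ : Equiv.Perm (Fin 6)) :
    ∃ g : C(ComplexPoints (fibre ψ), ComplexPoints (fibre ψ)), IsPermMap ψ ρ g := by
  induction ρ using Equiv.Perm.swap_induction_on with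
  | one => exact ⟨ContinuousMap.id _, isPermMap_one⟩
  | swap_mul f i j hij ih =>
    obtain ⟨g, hg⟩ := ih
    obtain ⟨r, hr⟩ := exists_continuousMap_isRefl ψ hij (one_pow 6 : (1 : ℂ) ^ 6 = 1)
    refine ⟨g.comp r, ?_⟩
    rw [Equiv.Perm.mul_def]
    exact hg.comp (isPermMap_swap_of_isReflMap hr)

/-- **Permutation maps preserve the `(p,q)`-classes of every FIXED Hodge model** (`ψ⁶ ≠ 1`).
[cite: VoisinHodgeI2002, §7.3.2] -/
theorem IsPermMap.pullback_mem_hodgePQ (hψ : ψ ^ 6 ≠ 1) {ρ : Equiv.Perm (Fin 6)}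
    {g : C(ComplexPoints (fibre ψ), ComplexPoints (fibre ψ))} (hg : IsPermMap ψ ρ g)
    (A : HodgeModel 4 (fibre ψ)) {k p q : ℕ} {c : complexBetti (fibre ψ) k}
    (hc : A.pullback k c ∈ A.hodgePQ k p q) :
    A.pullback k (singularCohomology.map ℂ ℂ g k c) ∈ A.hodgePQ k p q := by
  obtain ⟨g', hg', hH⟩ := exists_isPermMap_pullback_mem_hodgePQ hψ ρ
  rw [hg.unique hg']
  exact hH A k p q c hc

/-- A realising map `g` of `ρ` composed with one of `ρ⁻¹` is the identity (uniqueness of realising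
maps). [cite: BiniGarbagnati2012, §3.4] -/
theorem IsPermMap.comp_eq_id {ρ : Equiv.Perm (Fin 6)}
    {g g' : C(ComplexPoints (fibre ψ), ComplexPoints (fibre ψ))}
    (hg : IsPermMap ψ ρ g) (hg' : IsPermMap ψ ρ.symm g') : g.comp g' = ContinuousMap.id _ := by
  have h := hg.comp hg'
  rw [Equiv.self_trans_symm] at h
  exact h.unique isPermMap_one

/-- **`g^*` is injective** for a realising map of a permutation (it has the inverse `g'^*`,
`g'` realising `ρ⁻¹`; functoriality of `H^*`). [cite: HatcherAT2002, §3.1 p. 198] -/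
theorem IsPermMap.map_injective {ρ : Equiv.Perm (Fin 6)}
    {g : C(ComplexPoints (fibre ψ), ComplexPoints (fibre ψ))} (hg : IsPermMap ψ ρ g) (k : ℕ) :
    Function.Injective (singularCohomology.map ℂ ℂ g k) := by
  obtain ⟨g', hg'⟩ := exists_isPermMap (ψ := ψ) ρ.symm
  intro c c' h
  have key : ∀ d : complexBetti (fibre ψ) k,
      singularCohomology.map ℂ ℂ g' k (singularCohomology.map ℂ ℂ g k d) = d := fun d => by
    rw [← ModuleCat.comp_apply, ← singularCohomology.map_comp, hg.comp_eq_id hg',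
      singularCohomology.map_id]
    rfl
  rw [← key c, ← key c', h]

end Perm

/-! ### §2 Permutation maps permute the eigenspaces of `Γ_W` -/

section Eigen

variable {ψ : ℂ}

/-- `a ∘ ρ ∈ Γ_W` for `a ∈ Γ_W` (the conditions `aᵢ⁶ = 1`, `∏ aᵢ = 1` are symmetric). [cite: Katz2009, §2 p. 5] -/
def permEl (ρ : Equiv.Perm (Fin 6)) (a : gammaW) : gammaW :=
  ⟨fun k => (a : Fin (4 + 2) → ℂˣ) (ρ k), by
    refine mem_gammaW_iff.mpr ⟨fun i => (mem_gammaW_iff.mp a.2).1 (ρ i), ?_⟩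
    rw [Equiv.prod_comp ρ (fun k => (a : Fin (4 + 2) → ℂˣ) k)]
    exact (mem_gammaW_iff.mp a.2).2⟩

/-- Coordinates of `permEl ρ a`. [cite: Katz2009, §2 p. 5] -/
@[simp]
theorem permEl_apply (ρ : Equiv.Perm (Fin 6)) (a : gammaW) (k : Fin 6) :
    (permEl ρ a : Fin (4 + 2) → ℂˣ) k = (a : Fin (4 + 2) → ℂˣ) (ρ k) := rfl

/-- **`χ_{e∘ρ}(a∘ρ) = χ_e(a)`** (reindex the product). [cite: Katz2009, §2 p. 5] -/
theorem character_comp_permEl (e : Fin 6 → ℕ) (ρ : Equiv.Perm (Fin 6)) (a : gammaW) :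
    character (fun k => e (ρ k)) (permEl ρ a) = character e a := by
  ext
  rw [character_apply_val, character_apply_val]
  simp only [permEl_apply]
  exact Equiv.prod_comp ρ (fun k => (((a : Fin (4 + 2) → ℂˣ) k : ℂˣ) : ℂ) ^ e k)

/-- **`g_{a∘ρ} ∘ g = g ∘ g_a`** for a realising map `g` of the permutation `ρ` and the diagonal
symmetries `g_a : [x] ↦ [a • x]` (`a ∈ Γ_W`): both composites act on homogeneous coordinates by
`k ↦ a_{ρ k} x_{ρ k}`, so they agree (`eq_of_forall_rep_smul`). [cite: Katz2009, §2 p. 5]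
[cite: BiniGarbagnati2012, §3.4] -/
theorem diagonalMap_comp_of_isPermMap {ρ : Equiv.Perm (Fin 6)}
    {g : C(ComplexPoints (fibre ψ), ComplexPoints (fibre ψ))} (hg : IsPermMap ψ ρ g) (a : gammaW) :
    (diagonalMap (form ψ) (gammaW_le_diagonalStabilizer ψ (permEl ρ a).2)).comp g =
      g.comp (diagonalMap (form ψ) (gammaW_le_diagonalStabilizer ψ a.2)) := by
  have hG' := gammaW_le_diagonalStabilizer ψ
  refine eq_of_forall_rep_smul fun x => ?_
  -- left: `g_{a∘ρ} (g x)`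
  obtain ⟨t₁, ht₁⟩ := actsDiagonally_diagonalMap (hG' (permEl ρ a).2) (g x)
  obtain ⟨t₂, ht₂⟩ := hg x
  -- right: `g (g_a x)`
  obtain ⟨t₃, ht₃⟩ := hg (diagonalMap (form ψ) (hG' a.2) x)
  obtain ⟨t₄, ht₄⟩ := actsDiagonally_diagonalMap (hG' a.2) x
  refine ⟨fun k => (((a : Fin (4 + 2) → ℂˣ) (ρ k) : ℂˣ) : ℂ) * (pt ψ x).rep (ρ k),
    t₁ * t₂, t₃ * t₄, ?_, ?_⟩
  · rw [ContinuousMap.comp_apply]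
    change (pt ψ (diagonalMap (form ψ) (hG' (permEl ρ a).2) (g x))).rep = _
    rw [ht₁, ht₂]
    funext k
    simp only [Pi.smul_apply', Pi.smul_apply, smul_eq_mul, Units.smul_def, permEl_apply]
    ring
  · rw [ContinuousMap.comp_apply, ht₃]
    funext k
    simp only [Pi.smul_apply, smul_eq_mul]
    have h4 : (pt ψ (diagonalMap (form ψ) (hG' a.2) x)).rep (ρ k) =
        t₄ * ((((a : Fin (4 + 2) → ℂˣ) (ρ k) : ℂˣ) : ℂ) * (pt ψ x).rep (ρ k)) := by
      have := congrFun ht₄ (ρ k)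
      simpa only [Pi.smul_apply', Pi.smul_apply, smul_eq_mul, Units.smul_def] using this
    rw [h4]
    ring

/-- **Permutation maps permute the eigenspaces: `g^* V_{χ_{e∘ρ}} ⊆ V_{χ_e}`** for `g` realising
`ρ` (Katz §2: `𝔖ₙ` permutes the characters `V mod W`). From `g_{a∘ρ} ∘ g = g ∘ g_a`:
`g_a^* (g^* c) = g^* (g_{a∘ρ}^* c) = χ_{e∘ρ}(a∘ρ) g^* c = χ_e(a) g^* c`. [cite: Katz2009, §2 pp. 5–7] -/
theorem map_mem_eigenspace_of_isPermMap {ρ : Equiv.Perm (Fin 6)}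
    {g : C(ComplexPoints (fibre ψ), ComplexPoints (fibre ψ))} (hg : IsPermMap ψ ρ g)
    {e : Fin 6 → ℕ} {c : complexBetti (fibre ψ) (2 * 2)}
    (hc : c ∈ diagonalCharacterEigenspace (form ψ) gammaW (character fun k => e (ρ k)) (2 * 2)) :
    singularCohomology.map ℂ ℂ g (2 * 2) c ∈
      diagonalCharacterEigenspace (form ψ) gammaW (character e) (2 * 2) := by
  have hG' := gammaW_le_diagonalStabilizer ψ
  rw [mem_diagonalCharacterEigenspace_iff_diagonalMap hG'] at hc ⊢
  intro a
  have hcomm := congrArg (fun f : C(ComplexPoints (fibre ψ), ComplexPoints (fibre ψ)) =>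
    singularCohomology.map ℂ ℂ f (2 * 2) c) (diagonalMap_comp_of_isPermMap hg a)
  simp only [singularCohomology.map_comp, ModuleCat.comp_apply] at hcomm
  -- `hcomm : g^* (g_{a∘ρ}^* c) = g_a^* (g^* c)`
  rw [← hcomm, hc (permEl ρ a), map_smul, character_comp_permEl]

/-- Characters of `Γ_W` only see exponents mod `6` (`aᵢ⁶ = 1`). [cite: Katz2009, §2 p. 5] -/
theorem character_eq_of_mod_eq {e e' : Fin 6 → ℕ} (h : ∀ k, e k % 6 = e' k % 6) :
    character e = character e' := by
  ext a
  rw [character_apply_val, character_apply_val]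
  refine Finset.prod_congr rfl fun k _ => ?_
  have h6 := val_pow_six a k
  rw [← Nat.div_add_mod (e k) 6, ← Nat.div_add_mod (e' k) 6, pow_add, pow_add, pow_mul, pow_mul,
    h6, one_pow, one_pow, one_mul, one_mul, h k]

end Eigen

/-! ### §3 A class of two different Hodge types is zero -/

section TwoTypes

variable {n : ℕ} {X : SchemeOver ℂ}

/-- **A class of two different Hodge types in one model vanishes**: if `A^* c ∈ H^{p,q}_A` and
`A^* c ∈ H^{p',q'}_A` with `(p,q) ≠ (p',q')`, `p + q = p' + q' = k`, then `c = 0` — the pieces of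
the Hodge decomposition of the model are independent (field `HodgeModel.isInternal_hodgePQ`, Voisin I
Thm. 6.18), transported along the de Rham comparison, and `A^*` is injective.
[cite: VoisinHodgeI2002, Thm. 6.18 and Cor. 6.14] -/
theorem eq_zero_of_pullback_mem_hodgePQ_of_ne (A : HodgeModel n X) {k p q p' q' : ℕ}
    (hpq : p + q = k) (hpq' : p' + q' = k) (hne : (p, q) ≠ (p', q')) {c : complexBetti X k}
    (hc : A.pullback k c ∈ A.hodgePQ k p q) (hc' : A.pullback k c ∈ A.hodgePQ k p' q') : c = 0 := by
  set T := fun i : ↥(antidiagonal k) ↦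
    Literature.NumberTheory.Transcendental.hodgePQ A.model A.carrier k i.1.1 i.1.2 with hT
  have hind : iSupIndep T := (A.isInternal_hodgePQ k).submodule_iSupIndep
  let i₁ : ↥(antidiagonal k) := ⟨(p, q), Finset.HasAntidiagonal.mem_antidiagonal.2 hpq⟩
  let i₂ : ↥(antidiagonal k) := ⟨(p', q'), Finset.HasAntidiagonal.mem_antidiagonal.2 hpq'⟩
  have hne' : i₁ ≠ i₂ := fun h => hne (congrArg Subtype.val h)
  have hdisj : Disjoint (T i₁) (T i₂) := hind.pairwiseDisjoint hne'
  obtain ⟨w, hw, hwc⟩ := Submodule.mem_map.1 hc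
  obtain ⟨w', hw', hwc'⟩ := Submodule.mem_map.1 hc'
  have hww' : w = w' := (A.deRham A.carrier k).injective (hwc.trans hwc'.symm)
  have hw0 : w = 0 := (Submodule.disjoint_def.mp hdisj) w hw (hww' ▸ hw')
  have h0 : A.pullback k c = 0 := by rw [← hwc, hw0, map_zero]
  exact A.pullback_injective k (by rw [h0, map_zero])

end TwoTypes

/-! ### §4 Purity of a rank-one eigenspace whose inverse character is a permutation-translate -/

section Purity

variable {ψ : ℂ}

/-- **Purity from symmetry and rank one.** Let `ψ⁶ ≠ 1`, `A` a Hodge model of `X_ψ`, `e` an exponent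
vector and `ρ ∈ 𝔖₆` with `χ_{5e} = χ_{e∘ρ}` on `Γ_W` (`χ_e⁻¹ = χ_{5e}` is a permutation-translate of
`χ_e`), and suppose `V_{χ_e} ≤ ℂ·v` for some class `v` (rank `≤ 1`). Then `A^* V_{χ_e} ⊆ H^{2,2}_A`.
Proof: for `x ∈ V_{χ_e}` with `A^* x ∈ H^{p,q}`, `(p,q) ≠ (2,2)`, the class `y = g^* (conj x)`
(`g` realising `ρ`) lies in `V_{χ_e}` (`conj V_χ ⊆ V_{χ⁻¹}`, `g^* V_{χ_{e∘ρ}} ⊆ V_{χ_e}`) and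
`A^* y ∈ H^{q,p}` (Hodge symmetry of the model; `g^*` preserves types); `x`, `y` are both multiples
of `v`, and `y ≠ 0` if `x ≠ 0` (`conj`, `g^*` injective), so `x ∈ ℂ y` has the two types
`(p,q) ≠ (q,p)` and vanishes (`eq_zero_of_pullback_mem_hodgePQ_of_ne`); conclude by
`pullback_mem_hodgePQ_of_eigenspace`. [cite: Katz2009, Lemma 3.1] [cite: Ran1980, §1 Prop. 1.7 (iii)]
[cite: VoisinHodgeI2002, Cor. 6.12 and §7.3.2] [cite: Shioda1979PJA, §4] -/
theorem pullback_mem_hodgePQ_two_two_of_rank_le_one (hψ : ψ ^ 6 ≠ 1) (A : HodgeModel 4 (fibre ψ))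
    {e : Fin 6 → ℕ} (ρ : Equiv.Perm (Fin 6))
    (hρ : character (fun k => 5 * e k) = character (fun k => e (ρ k)))
    (hrank : ∃ v, diagonalCharacterEigenspace (form ψ) gammaW (character e) (2 * 2) ≤ ℂ ∙ v)
    {c : complexBetti (fibre ψ) (2 * 2)}
    (hc : c ∈ diagonalCharacterEigenspace (form ψ) gammaW (character e) (2 * 2)) :
    A.pullback (2 * 2) c ∈ A.hodgePQ (2 * 2) 2 2 := by
  have hG' := gammaW_le_diagonalStabilizer ψ
  have hX := isSmoothProjective_fibre hψ
  obtain ⟨g, hg⟩ := exists_isPermMap (ψ := ψ) ρ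
  obtain ⟨v, hv⟩ := hrank
  refine pullback_mem_hodgePQ_of_eigenspace (form ψ) hG' (character e) hX A
    (fun i hi hne x hx hxA => ?_) hc
  obtain ⟨p, q⟩ := i
  have hsum : p + q = 2 * 2 := Finset.HasAntidiagonal.mem_antidiagonal.1 hi
  have hpq : p ≠ q := by
    rintro rfl
    exact hne (Prod.ext (by change p = 2; omega) (by change p = 2; omega))
  -- `y = g^* (conj x) ∈ V_{χ_e}` of type `(q,p)`
  have hconj : conjClass (ComplexPoints (fibre ψ)) (2 * 2) x ∈
      diagonalCharacterEigenspace (form ψ) gammaW (character fun k => e (ρ k)) (2 * 2) := by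
    have h := conjClass_mem_diagonalCharacterEigenspace (form ψ) hG' (character e) hx
    rwa [character_inv, hρ] at h
  have hy : singularCohomology.map ℂ ℂ g (2 * 2) (conjClass (ComplexPoints (fibre ψ)) (2 * 2) x) ∈
      diagonalCharacterEigenspace (form ψ) gammaW (character e) (2 * 2) :=
    map_mem_eigenspace_of_isPermMap hg hconj
  have hconjA : A.pullback (2 * 2) (conjClass (ComplexPoints (fibre ψ)) (2 * 2) x) ∈
      A.hodgePQ (2 * 2) q p := by
    rw [A.pullback_conjClass]
    exact A.isHodgeSymmetric hX (2 * 2) p q _ hxA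
  have hyA := hg.pullback_mem_hodgePQ hψ A hconjA
  -- rank one
  obtain ⟨α, hα⟩ := Submodule.mem_span_singleton.mp (hv hx)
  obtain ⟨β, hβ⟩ := Submodule.mem_span_singleton.mp (hv hy)
  by_cases hβ0 : β = 0
  · have hy0 : singularCohomology.map ℂ ℂ g (2 * 2) (conjClass (ComplexPoints (fibre ψ)) (2 * 2) x) = 0 := by
      rw [← hβ, hβ0, zero_smul]
    have h1 : conjClass (ComplexPoints (fibre ψ)) (2 * 2) x = 0 :=
      hg.map_injective (2 * 2) (by rw [hy0, map_zero])
    rw [← conjClass_conjClass x, h1, conjClass_zero]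
  · have hxy : x = (α / β) •
        singularCohomology.map ℂ ℂ g (2 * 2) (conjClass (ComplexPoints (fibre ψ)) (2 * 2) x) := by
      rw [← hβ, smul_smul, div_mul_cancel₀ α hβ0, hα]
    have hxA' : A.pullback (2 * 2) x ∈ A.hodgePQ (2 * 2) q p := by
      rw [hxy, map_smul]
      exact Submodule.smul_mem _ _ hyA
    exact eq_zero_of_pullback_mem_hodgePQ_of_ne A hsum (by omega) (fun h => hpq (Prod.ext_iff.mp h).1)
      hxA hxA'

end Purity

/-! ### §5 The singleton flat type `(1,2,3,3,4,5)` -/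

section Singleton

variable {ψ : ℂ}

/-- `5·(1,2,3,3,4,5) ≡ (5,4,3,3,2,1) = (1,2,3,3,4,5) ∘ rev (mod 6)`: the inverse of the singleton
character is the character read backwards. [cite: Katz2009, Lemma 3.1] -/
theorem five_mul_flatTypes_zero_mod (m : Fin 6) :
    (5 * flatTypes 0 m) % 6 = flatTypes 0 (Fin.rev m) % 6 := by
  fin_cases m <;> decide

/-- `6 − (1,2,3,3,4,5) = (5,4,3,3,2,1) = (1,2,3,3,4,5) ∘ rev`: the conjugate type of the singleton
type is the singleton type read backwards. [cite: Katz2009, Lemma 3.1] -/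
theorem six_sub_flatTypes_zero (m : Fin 6) : 6 - flatTypes 0 m = flatTypes 0 (Fin.rev m) := by
  fin_cases m <;> decide

/-- For `e = (1,2,3,3,4,5) ∘ σ`: `χ_{5e} = χ_{e∘ρ}` with `ρ = σ ∘ rev ∘ σ⁻¹` (as maps, `k ↦ σ⁻¹(rev(σ k))`).
[cite: Katz2009, Lemma 3.1] -/
theorem character_five_mul_singleton (σ : Equiv.Perm (Fin 6)) :
    character (fun k => 5 * flatTypes 0 (σ k)) =
      character (fun k => flatTypes 0 (σ (((σ.trans Fin.revPerm).trans σ.symm) k))) := by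
  refine character_eq_of_mod_eq fun k => ?_
  simp only [Equiv.trans_apply, Fin.revPerm_apply, Equiv.apply_symm_apply]
  exact five_mul_flatTypes_zero_mod (σ k)

/-- **The singleton eigenlines are of type `(2,2)`, granted rank `≤ 1`** (`ψ⁶ ≠ 1`, any Hodge model
`A`, any position `σ`): if every `V_{χ_{(1,2,3,3,4,5)∘τ}}`, `τ ∈ 𝔖₆`, is contained in a line, then
`A^* V_{χ_{(1,2,3,3,4,5)∘σ}} ⊆ H^{2,2}_A`. This is the purity part of Katz's Lemma 3.1(2) for the
360 rank-one pieces, from its rank part 3.1(1) and symmetry alone. [cite: Katz2009, Lemma 3.1] -/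
theorem pullback_mem_hodgePQ_two_two_singleton_of_rank_le_one (hψ : ψ ^ 6 ≠ 1)
    (A : HodgeModel 4 (fibre ψ)) (σ : Equiv.Perm (Fin 6))
    (hrank : ∀ τ : Equiv.Perm (Fin 6), ∃ v,
      diagonalCharacterEigenspace (form ψ) gammaW (character fun k => flatTypes 0 (τ k)) (2 * 2) ≤ ℂ ∙ v)
    {c : complexBetti (fibre ψ) (2 * 2)}
    (hc : c ∈ diagonalCharacterEigenspace (form ψ) gammaW (character fun k => flatTypes 0 (σ k)) (2 * 2)) :
    A.pullback (2 * 2) c ∈ A.hodgePQ (2 * 2) 2 2 :=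
  pullback_mem_hodgePQ_two_two_of_rank_le_one hψ A (e := fun k => flatTypes 0 (σ k))
    ((σ.trans Fin.revPerm).trans σ.symm) (character_five_mul_singleton σ) (hrank σ) hc

/-- `IsEig` / `∃`-model form: under the rank hypothesis, eigenclasses of the singleton type
`(1,2,3,3,4,5) ∘ σ` and of its conjugate `6 − (1,2,3,3,4,5) ∘ σ` are `IsOfHodgeType 4 X_ψ 4 2 2`
(Hodge models exist, `nonempty_hodgeModel_holds`). [cite: Katz2009, Lemma 3.1] -/
theorem isOfHodgeType_two_two_singleton_of_rank_le_one (hψ : ψ ^ 6 ≠ 1) (σ : Equiv.Perm (Fin 6))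
    (hrank : ∀ τ : Equiv.Perm (Fin 6), ∃ v,
      diagonalCharacterEigenspace (form ψ) gammaW (character fun k => flatTypes 0 (τ k)) (2 * 2) ≤ ℂ ∙ v)
    {u v : complexBetti (fibre ψ) (2 * 2)}
    (hu : IsEig ψ (fun l => flatTypes 0 (σ l)) u) (hv : IsEig ψ (fun l => 6 - flatTypes 0 (σ l)) v) :
    IsOfHodgeType 4 (fibre ψ) (2 * 2) 2 2 u ∧ IsOfHodgeType 4 (fibre ψ) (2 * 2) 2 2 v := by
  obtain ⟨A⟩ := nonempty_hodgeModel_holds (n := 4) (X := fibre ψ) (isSmoothProjective_fibre hψ)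
  have hv' : IsEig ψ (fun l => flatTypes 0 ((σ.trans Fin.revPerm) l)) v := by
    have h : (fun l => 6 - flatTypes 0 (σ l)) = fun l => flatTypes 0 ((σ.trans Fin.revPerm) l) :=
      funext fun l => by rw [Equiv.trans_apply, Fin.revPerm_apply]; exact six_sub_flatTypes_zero (σ l)
    rw [h] at hv
    exact hv
  exact ⟨⟨A, pullback_mem_hodgePQ_two_two_singleton_of_rank_le_one hψ A σ hrank
      (mem_eigenspace_of_isEig hu)⟩,
    ⟨A, pullback_mem_hodgePQ_two_two_singleton_of_rank_le_one hψ A (σ.trans Fin.revPerm) hrank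
      (mem_eigenspace_of_isEig hv')⟩⟩

/-- **Crux K2 for the singleton type, granted rank `≤ 1` instead of Katz/Griffiths.** For `ψ⁶ ≠ 1`,
`σ ∈ 𝔖₆`, and every RATIONAL class `w = u + v` with `u` an eigenclass of exponent `(1,2,3,3,4,5) ∘ σ`
and `v` one of exponent `(6 − (1,2,3,3,4,5)) ∘ σ`: if the eigenspaces `V_{χ_{(1,2,3,3,4,5)∘τ}}`
(`τ ∈ 𝔖₆`) of `H⁴(X_ψ(ℂ); ℂ)` are contained in lines, then `w` lies in the `ℂ`-span of the rational
`(2,2)`-classes invariant under some realised reflection `s_(i,i',ζ)` — the `j = 0` instance of the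
body of `FlatClassesSpannedByReflectionInvariants` (route `DworkReflectionQuotients`), by
`isOfHodgeType_two_two_singleton_of_rank_le_one` and the six-reflection averaging identity
`mem_span_reflInvariant_of_isEig_add`. Compare `flatClasses_mem_span_reflInvariant_of_katz` /
`…_of_griffiths` (all four types, conditional on a named fact). [cite: Katz2009, Lemma 3.1 and §2 pp. 5–7]
[cite: BiniGarbagnati2012, §3.4] -/
theorem flatClasses_mem_span_reflInvariant_singleton_of_rank_le_one {ψ : ℂ} (hψ : ψ ^ 6 ≠ 1)
    (σ : Equiv.Perm (Fin 6))
    (hrank : ∀ τ : Equiv.Perm (Fin 6), ∃ v,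
      diagonalCharacterEigenspace (form ψ) gammaW (character fun k => flatTypes 0 (τ k)) (2 * 2) ≤ ℂ ∙ v)
    (w : complexBetti (fibre ψ) (2 * 2)) (hrat : IsRationalClass w)
    (huv : ∃ u v : complexBetti (fibre ψ) (2 * 2), IsEig ψ (fun l => flatTypes 0 (σ l)) u ∧
      IsEig ψ (fun l => 6 - flatTypes 0 (σ l)) v ∧ w = u + v) :
    w ∈ Submodule.span ℂ {c : complexBetti (fibre ψ) (2 * 2) | IsRationalClass c ∧
      IsOfHodgeType 4 (fibre ψ) (2 * 2) 2 2 c ∧ ∃ i i' : Fin 6, i ≠ i' ∧ ∃ ζ : ℂ, ζ ^ 6 = 1 ∧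
        ∃ g : C(Motives.ComplexPoints (fibre ψ), Motives.ComplexPoints (fibre ψ)),
          (∀ x, ∃ t : ℂ, (pt ψ (g x)).rep = t • (fun k => if k = i then ζ * (pt ψ x).rep i'
            else if k = i' then ζ⁻¹ * (pt ψ x).rep i else (pt ψ x).rep k)) ∧
          singularCohomology.map ℂ ℂ g (2 * 2) c = c} := by
  obtain ⟨u, v, hu, hv, hw⟩ := huv
  obtain ⟨hne, hne'⟩ := flatTypes_zero_ne_five 0
  obtain ⟨hu2, hv2⟩ := isOfHodgeType_two_two_singleton_of_rank_le_one hψ σ hrank hu hv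
  have hij : σ.symm 0 ≠ σ.symm 5 := fun h => by simpa using congrArg σ h
  exact mem_span_reflInvariant_of_isEig_add hψ hij (e := fun l => flatTypes 0 (σ l))
    (e' := fun l => 6 - flatTypes 0 (σ l)) (by simpa using hne) (by simpa using hne') hu hv hw hrat
    (hw ▸ hu2.add (isSmoothProjective_fibre hψ) hv2)

end Singleton

end Literature.AlgebraicGeometry.HodgeTheory.DworkSextic

end
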